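import Summits.Parity.GeneralizedHardyLittlewood.Theorems.DilatedTableChowla.Negative.DilatedTableChowlaPointwise

/-!
# Harmonic quarantine of non-generic dilations — `DilatedTableChowla` (stmt-Parity-14271)

Support file for the crux `LiouvilleShiftedTables.DilatedTableChowla`, line `positivity-quarantine`
(lead prover c1): the COMBINATORIAL half of the line's composition, for an arbitrary predicate
`Good` on moduli ("Linnik-box zero-free" in the application,
`LiouvilleShiftedTablesDilatedTableChowlaQuarantine`).  Call a dilation `q` GENERIC when every
modulus `n`, `q ∣ n`, `n ≤ q (log x)^κ`, is `Good`.  If the non-`Good` moduli `≤ x^θ` are the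
multiples of a finite set `S` of non-`Good` moduli (Bombieri's log-free density theorem supplies
this with `|S| ≤ (log x)^{E₀}`) and every modulus `≤ (log x)^K` is `Good` (classical zero-free region
+ Siegel), then the non-generic `q ≤ Q` (`Q (log x)^κ ≤ x^θ`) have harmonic mass
`Σ 1/q ≤ |S| (log x)^{2κ} (1 + log Q) / (log x)^K` (`nonGeneric_harmonic_le`).  The point is the
GCD TRICK `exists_cover_dvd`: a bad modulus `s ∣ q·m` gives the divisor `s/e ∣ q` with `e ∣ s`,
`e ≤ m ≤ (log x)^κ`, so `s/e > (log x)^{K−κ}`, and the multiples of one modulus `t` have harmonic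
mass `≤ (1 + log Q)/t` (`Negative.sum_inv_multiples_le`).  No new definitions. [folklore]
-/

noncomputable section

namespace Summit.Parity.GeneralizedHardyLittlewood.Theorems.DilatedTableChowla.Quarantine

open Finset
open scoped Classical
open Summit.Parity.GeneralizedHardyLittlewood.Theorems.DilatedTableChowla.Negative

/-! ### §1 Abstract harmonic quarantine (pure combinatorics of a predicate `Good` on moduli) -/

/-- A sum over a `biUnion` of non-negative terms is at most the sum of the sums. [folklore] -/
theorem sum_biUnion_le_sum (s : Finset ℕ) (t : ℕ → Finset ℕ) (f : ℕ → ℝ) (hf : ∀ i, 0 ≤ f i) :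
    ∑ q ∈ s.biUnion t, f q ≤ ∑ i ∈ s, ∑ q ∈ t i, f q := by
  refine Finset.induction_on s (by simp) ?_
  intro a s ha ih
  rw [Finset.biUnion_insert, Finset.sum_insert ha]
  have hui := Finset.sum_union_inter (s₁ := t a) (s₂ := s.biUnion t) (f := f)
  have hnn : 0 ≤ ∑ q ∈ t a ∩ s.biUnion t, f q := Finset.sum_nonneg fun i _ => hf i
  linarith

/-- THE GCD TRICK: `s ∣ q m` ⟹ `s = e · (s/e)` with `s/e ∣ q`, `e ∣ s`, `1 ≤ e ≤ m`. [folklore] -/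
theorem exists_cover_dvd {s q m : ℕ} (hs : 1 ≤ s) (hm : 1 ≤ m) (h : s ∣ q * m) :
    ∃ e : ℕ, 1 ≤ e ∧ e ≤ m ∧ e ∣ s ∧ s / e ∣ q := by
  set t := Nat.gcd s q with htdef
  have ht : 0 < t := Nat.gcd_pos_of_pos_left _ hs
  have hts : t ∣ s := Nat.gcd_dvd_left s q
  have htq : t ∣ q := Nat.gcd_dvd_right s q
  have hcop : Nat.Coprime (s / t) (q / t) := Nat.coprime_div_gcd_div_gcd ht
  have hdvd : s / t ∣ (q / t) * m := by
    have h' : (s / t) * t ∣ ((q / t) * m) * t := by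
      have e1 : (s / t) * t = s := Nat.div_mul_cancel hts
      have e2 : ((q / t) * m) * t = q * m := by
        calc ((q / t) * m) * t = (q / t * t) * m := by ring
          _ = q * m := by rw [Nat.div_mul_cancel htq]
      rw [e1, e2]; exact h
    exact Nat.dvd_of_mul_dvd_mul_right ht h'
  have hstm : s / t ∣ m := hcop.dvd_of_dvd_mul_left hdvd
  have hs0 : s ≠ 0 := by omega
  refine ⟨s / t, Nat.div_pos (Nat.le_of_dvd hs hts) ht, Nat.le_of_dvd hm hstm,
    Nat.div_dvd_of_dvd hts, ?_⟩
  rw [Nat.div_div_self hts hs0]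
  exact htq

/-- The quarantine moduli `s/e` (`s ∈ S`, `1 ≤ e ≤ M`, `e ∣ s`) number at most `|S|·M`. [folklore] -/
theorem card_cover_le (S : Finset ℕ) (M : ℕ) :
    (S.biUnion (fun s => ((Finset.Icc 1 M).filter (fun e => e ∣ s)).image (fun e => s / e))).card ≤
      S.card * M := by
  calc (S.biUnion (fun s => ((Finset.Icc 1 M).filter (fun e => e ∣ s)).image (fun e => s / e))).card
      ≤ ∑ s ∈ S, (((Finset.Icc 1 M).filter (fun e => e ∣ s)).image (fun e => s / e)).card :=
        Finset.card_biUnion_le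
    _ ≤ ∑ s ∈ S, M := Finset.sum_le_sum fun s _ =>
        Finset.card_image_le.trans ((Finset.card_filter_le _ _).trans (by simp))
    _ = S.card * M := by rw [Finset.sum_const, smul_eq_mul]

/-- STRUCTURE of the non-generic dilations.  Call a dilation `q` GENERIC when every modulus `n`,
`q ∣ n`, `n ≤ q (log x)^κ`, is `Good`.  If every non-`Good` modulus `d ≤ x^θ` is a multiple of some
`s ∈ S` and `Q (log x)^κ ≤ x^θ`, then every non-generic `q ≤ Q` is a multiple of a quarantine
modulus `s/e`, `s ∈ S`, `e ≤ (log x)^κ`, `e ∣ s` (the gcd trick). [folklore] -/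
theorem nonGeneric_subset {Good : ℕ → Prop} {x θ κ : ℝ} {Q : ℕ} {S : Finset ℕ} (hx : 1 ≤ x)
    (hGood0 : Good 0)
    (hcover : ∀ d : ℕ, 1 ≤ d → (d : ℝ) ≤ x ^ θ → ¬ Good d → ∃ s ∈ S, s ∣ d)
    (hQ : (Q : ℝ) * Real.log x ^ κ ≤ x ^ θ) :
    (Finset.Icc 1 Q).filter (fun q => ¬ ∀ n : ℕ, q ∣ n → (n : ℝ) ≤ q * Real.log x ^ κ → Good n) ⊆
      (S.biUnion (fun s => ((Finset.Icc 1 ⌊Real.log x ^ κ⌋₊).filter (fun e => e ∣ s)).image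
        (fun e => s / e))).biUnion (fun t => (Finset.Icc 1 Q).filter (fun q => t ∣ q)) := by
  intro q hq
  obtain ⟨hqI, hng⟩ := Finset.mem_filter.1 hq
  obtain ⟨hq1, hqQ⟩ := Finset.mem_Icc.1 hqI
  have hqpos : (0 : ℝ) < q := by exact_mod_cast hq1
  have hLk : 0 ≤ Real.log x ^ κ := Real.rpow_nonneg (Real.log_nonneg hx) κ
  push Not at hng
  obtain ⟨n, hqn, hnle, hbad⟩ := hng
  have hn0 : n ≠ 0 := by
    rintro rfl; exact hbad hGood0
  obtain ⟨m, rfl⟩ := hqn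
  have hm1 : 1 ≤ m := by
    rcases Nat.eq_zero_or_pos m with h0 | h0
    · subst h0; simp at hn0
    · exact h0
  have hmle : (m : ℝ) ≤ Real.log x ^ κ := by
    have : (q : ℝ) * m ≤ q * Real.log x ^ κ := by exact_mod_cast hnle
    exact le_of_mul_le_mul_left this hqpos
  have hmM : m ≤ ⌊Real.log x ^ κ⌋₊ := Nat.le_floor hmle
  have hd1 : 1 ≤ q * m := Nat.one_le_iff_ne_zero.2 hn0
  have hdθ : ((q * m : ℕ) : ℝ) ≤ x ^ θ := by
    push_cast
    calc (q : ℝ) * m ≤ Q * Real.log x ^ κ := by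
          have hqQ' : (q : ℝ) ≤ Q := by exact_mod_cast hqQ
          exact mul_le_mul hqQ' hmle (by positivity) (by positivity)
      _ ≤ x ^ θ := hQ
  obtain ⟨s, hsS, hsd⟩ := hcover (q * m) hd1 hdθ hbad
  have hs1 : 1 ≤ s := Nat.pos_of_dvd_of_pos hsd (by omega)
  obtain ⟨e, he1, hem, hes, hsq⟩ := exists_cover_dvd hs1 hm1 hsd
  refine Finset.mem_biUnion.2 ⟨s / e, ?_, Finset.mem_filter.2 ⟨hqI, hsq⟩⟩
  exact Finset.mem_biUnion.2 ⟨s, hsS, Finset.mem_image.2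
    ⟨e, Finset.mem_filter.2 ⟨Finset.mem_Icc.2 ⟨he1, hem.trans hmM⟩, hes⟩, rfl⟩⟩

/-- HARMONIC QUARANTINE: if moreover every modulus `≤ (log x)^K` is `Good` and every `s ∈ S` is not,
the non-generic dilations `q ≤ Q` have harmonic mass `≤ |S| (log x)^{2κ} (1 + log Q) / (log x)^K`
(each quarantine modulus `s/e ≥ s/(log x)^κ > (log x)^{K−κ}` has multiples of harmonic mass
`≤ (1 + log Q)/(s/e)`, `Negative.sum_inv_multiples_le`). [folklore] -/
theorem nonGeneric_harmonic_le {Good : ℕ → Prop} {x θ K κ : ℝ} {Q : ℕ} {S : Finset ℕ} (hx : 1 < x)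
    (hGood0 : Good 0) (hSbad : ∀ s ∈ S, ¬ Good s)
    (hcover : ∀ d : ℕ, 1 ≤ d → (d : ℝ) ≤ x ^ θ → ¬ Good d → ∃ s ∈ S, s ∣ d)
    (hsmall : ∀ d : ℕ, 1 ≤ d → (d : ℝ) ≤ Real.log x ^ K → Good d)
    (hQ : (Q : ℝ) * Real.log x ^ κ ≤ x ^ θ) :
    ∑ q ∈ (Finset.Icc 1 Q).filter
        (fun q => ¬ ∀ n : ℕ, q ∣ n → (n : ℝ) ≤ q * Real.log x ^ κ → Good n), ((q : ℝ))⁻¹ ≤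
      S.card * (Real.log x ^ κ) ^ 2 * (1 + Real.log Q) / Real.log x ^ K := by
  have hx1 : 1 ≤ x := hx.le
  have hlog : 0 < Real.log x := Real.log_pos hx
  have hLk : 0 ≤ Real.log x ^ κ := Real.rpow_nonneg hlog.le κ
  have hLK : 0 < Real.log x ^ K := Real.rpow_pos_of_pos hlog K
  have hlogQ : 0 ≤ 1 + Real.log Q := by linarith [Real.log_natCast_nonneg Q]
  set M : ℕ := ⌊Real.log x ^ κ⌋₊ with hMdef
  have hMle : (M : ℝ) ≤ Real.log x ^ κ := Nat.floor_le hLk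
  set T : Finset ℕ :=
    S.biUnion (fun s => ((Finset.Icc 1 M).filter (fun e => e ∣ s)).image (fun e => s / e)) with hTdef
  -- every quarantine modulus is large: `t = s/e ≥ s/M > (log x)^K / (log x)^κ`
  have hbig : ∀ t ∈ T, (1 + Real.log Q) / t ≤
      (1 + Real.log Q) * Real.log x ^ κ / Real.log x ^ K := by
    intro t ht
    obtain ⟨s, hsS, hts⟩ := Finset.mem_biUnion.1 ht
    obtain ⟨e, he, rfl⟩ := Finset.mem_image.1 hts
    obtain ⟨heI, hes⟩ := Finset.mem_filter.1 he
    obtain ⟨he1, heM⟩ := Finset.mem_Icc.1 heI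
    have hs0 : s ≠ 0 := by
      rintro rfl; exact hSbad 0 hsS hGood0
    have hs1 : 1 ≤ s := Nat.one_le_iff_ne_zero.2 hs0
    -- (Z1), contrapositive: a bad modulus exceeds (log x)^K
    have hsK : Real.log x ^ K < s := by
      by_contra hle
      exact hSbad s hsS (hsmall s hs1 (not_lt.1 hle))
    have hepos : (0 : ℝ) < e := by exact_mod_cast he1
    have hspos : (0 : ℝ) < s := by exact_mod_cast hs1
    have hcast : (((s / e : ℕ)) : ℝ) = (s : ℝ) / e := Nat.cast_div hes hepos.ne'
    have htpos : (0 : ℝ) < (s : ℝ) / e := div_pos hspos hepos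
    rw [hcast, div_le_div_iff₀ htpos hLK]
    have heM' : (e : ℝ) ≤ Real.log x ^ κ := le_trans (by exact_mod_cast heM) hMle
    have : Real.log x ^ K * e ≤ Real.log x ^ κ * s := by
      calc Real.log x ^ K * e ≤ s * Real.log x ^ κ :=
            mul_le_mul hsK.le heM' hepos.le hspos.le
        _ = Real.log x ^ κ * s := by ring
    calc (1 + Real.log Q) * Real.log x ^ K
        = (1 + Real.log Q) * (Real.log x ^ K * e) / e := by field_simp
      _ ≤ (1 + Real.log Q) * (Real.log x ^ κ * s) / e := by gcongr
      _ = (1 + Real.log Q) * Real.log x ^ κ * (s / e) := by field_simp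
  calc ∑ q ∈ (Finset.Icc 1 Q).filter
          (fun q => ¬ ∀ n : ℕ, q ∣ n → (n : ℝ) ≤ q * Real.log x ^ κ → Good n), ((q : ℝ))⁻¹
      ≤ ∑ q ∈ T.biUnion (fun t => (Finset.Icc 1 Q).filter (fun q => t ∣ q)), ((q : ℝ))⁻¹ :=
        Finset.sum_le_sum_of_subset_of_nonneg (nonGeneric_subset hx1 hGood0 hcover hQ)
          fun q _ _ => by positivity
    _ ≤ ∑ t ∈ T, ∑ q ∈ (Finset.Icc 1 Q).filter (fun q => t ∣ q), ((q : ℝ))⁻¹ :=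
        sum_biUnion_le_sum _ _ _ fun q => by positivity
    _ ≤ ∑ t ∈ T, (1 + Real.log Q) / t := by
        refine Finset.sum_le_sum fun t ht => ?_
        obtain ⟨s, hsS, hts⟩ := Finset.mem_biUnion.1 ht
        obtain ⟨e, he, rfl⟩ := Finset.mem_image.1 hts
        obtain ⟨heI, hes⟩ := Finset.mem_filter.1 he
        obtain ⟨he1, heM⟩ := Finset.mem_Icc.1 heI
        have hs0 : s ≠ 0 := by
          rintro rfl; exact hSbad 0 hsS hGood0
        have ht1 : 1 ≤ s / e :=
          Nat.div_pos (Nat.le_of_dvd (Nat.one_le_iff_ne_zero.2 hs0) hes) (by omega)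
        exact sum_inv_multiples_le ht1 Q
    _ ≤ ∑ t ∈ T, (1 + Real.log Q) * Real.log x ^ κ / Real.log x ^ K := Finset.sum_le_sum hbig
    _ = T.card * ((1 + Real.log Q) * Real.log x ^ κ / Real.log x ^ K) := by
        rw [Finset.sum_const, nsmul_eq_mul]
    _ ≤ (S.card * Real.log x ^ κ) * ((1 + Real.log Q) * Real.log x ^ κ / Real.log x ^ K) := by
        have hcard : (T.card : ℝ) ≤ S.card * Real.log x ^ κ := by
          calc (T.card : ℝ) ≤ ((S.card * M : ℕ) : ℝ) := by exact_mod_cast card_cover_le S M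
            _ = S.card * (M : ℝ) := by push_cast; ring
            _ ≤ S.card * Real.log x ^ κ := by gcongr
        have hnn : 0 ≤ (1 + Real.log Q) * Real.log x ^ κ / Real.log x ^ K :=
          div_nonneg (mul_nonneg hlogQ hLk) hLK.le
        exact mul_le_mul_of_nonneg_right hcard hnn
    _ = S.card * (Real.log x ^ κ) ^ 2 * (1 + Real.log Q) / Real.log x ^ K := by
        field_simp

end Summit.Parity.GeneralizedHardyLittlewood.Theorems.DilatedTableChowla.Quarantine

end
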